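import Mathlib
import HarnessLib
import Literature.Analysis.FluidPDE.ESSLocalHolderTopCylinder
import Literature.Analysis.FluidPDE.SereginSverakPressureProofs
import Literature.Analysis.FluidPDE.ConstantinDirectionDissipationProofs
import Literature.Analysis.FluidPDE.MollifiedSliceTools
import Literature.Analysis.FluidPDE.NSSuitableESSProofs
import Literature.Analysis.FluidPDE.ClassicalSuitable

/-!
# Shelf 1574, LINE 9 «trace_transfer»: STUB 4 — bounded `L³(B(x₀,ρ))` slices on a terminal window
# force boundedness on a backward parabolic cylinder at the vertex `(T, x₀)` (ESS 2003 Thm 1.4, local)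

Helper file (`--supports stmt-NavierStokesRegularity-1574 --as helper`) for the banked line
`Cruxes/EnstrophyQuarterLaw/Lines/trace_transfer.lean` (ns-idea-9 g4, LINE 9; idea-crit-8 V35
PASS-WITH-PRICE «corollary grade»; KEY-NS #131 (1): typed cross-route edge 1574 ⇒ 18384/18385). The
main statement is the line's registered `stub_regular_of_localSliceL3` with its Cruxes-local predicate
`LocalSliceL3Bound` UNFOLDED VERBATIM (size M):

  classical on `[0,T) × ℝ³`, Leray–Hopf on `[0,T]`, and `∫_{B(x₀,ρ)} |u(s)|³ ≤ C` for `s ∈ (t₀, T)`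
  ⇒ `∃ r > 0`, `u ∈ L^∞(Q_r(T, x₀))`.

PROOF (all inputs are tree theorems): shrink to a radius `r ≤ ρ` with `r² ≤ T`, `r² ≤ T − t₀`; the pair
`(u, p̃)` (Riesz-normalised pressure gauge `p̃ = p − (p(·,0) − ϖ[u](0))`) lies in Lemarié-Rieusset's §14.3
suitable class on the top cylinder `Q_r(T, x₀)` — `exists_isLRSuitableWeakSolutionOn_cylinder_top_of_classical`,
which is `FluidComputer.LocalCriticalDivergence.exists_isLRSuitableWeakSolutionOn_cylinder_top` with its idle
maximality hypothesis removed (the dissipation through `T` is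
`IsLerayHopfOn.lintegral_frobeniusNormSq_fderiv_of_classical`, which only takes the classical solution); then
Escauriaza–Seregin–Šverák's local theorem AT THE TOP of the cylinder, every viscosity and size
(`ess_bounded_near_top_of_L3`, built on the tree's DISCHARGED `ess_local_holder_holds`), at `z = (T, x₀)`.
The rapid-decay hypothesis of the registered signature is not used.

No summit statement is proved: `EnstrophyQuarterLaw` (1574), `TraceScarL3` (18384), `TypeITraceScarL3`
(18385) stay OPEN; this file is a packaging of ESS's local theorem for classical Leray–Hopf solutions.

## References

* L. Escauriaza, G. Seregin, V. Šverák, Russ. Math. Surveys 58 (2003) 211–250, Thm. 1.4, §3.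
  [EscauriazaSereginSverak2003]
* P. G. Lemarié-Rieusset, *The Navier–Stokes Problem in the 21st Century*, CRC 2016, §14.3. [LemarieRieusset2016]
-/

noncomputable section

-- the summit-side namespace repeats a component by design (D-0017)
set_option linter.dupNamespace false

namespace Summit.NavierStokesRegularity.NavierStokesRegularity.Theorems.EnstrophyQuarterLaw.TraceTransfer

open Set MeasureTheory Function Metric Filter Topology TopologicalSpace
open scoped ENNReal NNReal RealInnerProductSpace
open Literature.Analysis.FluidPDE Literature.Analysis.FunctionSpaces

variable {ν T : ℝ} {u : ℝ → EuclideanSpace ℝ (Fin 3) → EuclideanSpace ℝ (Fin 3)}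
  {p : ℝ → EuclideanSpace ℝ (Fin 3) → ℝ}

/-- **Lemarié-Rieusset's §14.3 class on every backward cylinder `Q_r(T, x₀)` whose top is the final time,
for a CLASSICAL Leray–Hopf solution** (no maximality): for `(u, p)` classical on `[0, T) × ℝ³` (`ν > 0`,
`T > 0`), Leray–Hopf on `[0, T]` from `u 0`, and `0 < r`, `r² ≤ T`, the pair `(u, p̃)` with the Riesz-normalised
pressure gauge `p̃(t, x) = p(t, x) − (p(t, 0) − ϖ[u(t)](0))` satisfies the eight §14.3 hypotheses on
`Q_r(T, x₀)` with force exponent `3` and force `0`: connected domain, `u ∈ L^∞_t L²_x` (Leray's energy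
inequality), a weak gradient square-integrable THROUGH `T` (a.e. identification with the classical gradient,
`IsLerayHopfOn.lintegral_frobeniusNormSq_fderiv_of_classical`), `p̃ ∈ L^{3/2}` of the slab
(`SereginSverak2002.lintegral_slab_gauged_pressure_lt_top`), the equations and the local energy inequality
restricted from the open slab (`SereginSverak2002.isSuitableWeakSolutionOn_gauge_of_classical`).
[cite: LemarieRieusset2016, §14.3 hypotheses of Thm. 14.4 (p. 505)] -/
-- adapted from Summits/NavierStokesRegularity/FluidComputer/LocalCriticalDivergence.lean
-- (`exists_isLRSuitableWeakSolutionOn_cylinder_top`, maximal version; maximality is idle there)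
theorem exists_isLRSuitableWeakSolutionOn_cylinder_top_of_classical (hν : 0 < ν) (hT : 0 < T)
    (hcl : IsClassicalNSSolutionOn (Ico 0 T) ν 0 u p) (hLH : IsLerayHopfOn T ν 0 (u 0) u)
    (x₀ : EuclideanSpace ℝ (Fin 3)) {r : ℝ} (hr : 0 < r) (hrT : r ^ 2 ≤ T) :
    ∃ G : ℝ → EuclideanSpace ℝ (Fin 3) → EuclideanSpace ℝ (Fin 3) →L[ℝ] EuclideanSpace ℝ (Fin 3),
      IsLRSuitableWeakSolutionOn (parabolicCylinderOpens r ((T : ℝ), x₀)) ν 3 0 u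
        (fun t x => p t x - (p t 0 - normalisedPressure (u t) 0)) G := by
  set qg : ℝ → EuclideanSpace ℝ (Fin 3) → ℝ := fun t x => p t x - (p t 0 - normalisedPressure (u t) 0)
    with hqg
  set Q : Opens (ℝ × EuclideanSpace ℝ (Fin 3)) :=
    ⟨Ioo 0 T ×ˢ univ, isOpen_Ioo.prod isOpen_univ⟩ with hQdef
  have hQ : (Q : Set (ℝ × EuclideanSpace ℝ (Fin 3))) ⊆ Ioo 0 T ×ˢ univ := Subset.rfl
  have hsw : IsSuitableWeakSolutionOn Q ν 0 u qg :=
    SereginSverak2002.isSuitableWeakSolutionOn_gauge_of_classical hν hT hcl hLH Q hQ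
  obtain ⟨G, hG, -, hloc⟩ := hsw.localEnergy
  set Ω : Opens (ℝ × EuclideanSpace ℝ (Fin 3)) := parabolicCylinderOpens r ((T : ℝ), x₀) with hΩdef
  have hΩ : (Ω : Set (ℝ × EuclideanSpace ℝ (Fin 3))) = parabolicCylinder r ((T : ℝ), x₀) := rfl
  have hΩsub : (Ω : Set (ℝ × EuclideanSpace ℝ (Fin 3))) ⊆
      Ioo 0 T ×ˢ (univ : Set (EuclideanSpace ℝ (Fin 3))) := by
    intro z hz
    have hz' : z ∈ parabolicCylinder r ((T : ℝ), x₀) := hz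
    rw [mem_parabolicCylinder] at hz'
    exact ⟨⟨by nlinarith [hz'.1.1], hz'.1.2⟩, mem_univ _⟩
  have hΩle : Ω ≤ Q := fun z hz => hΩsub hz
  -- the classical gradient is a weak gradient on the slab; identify it with `G` a.e.
  have hfd : HasWeakSpatialGradientOn Q u fun t x => fderiv ℝ (u t) x :=
    hasWeakSpatialGradientOn_of_contDiffOn isOpen_Ioo hQ
      ((hcl.mono Ioo_subset_Ico_self isOpen_Ioo.uniqueDiffOn).smooth_velocity.of_le (by norm_cast))
  have hae := hG.ae_eq hfd
  -- energy, dissipation through `T`, gauged pressure on the slab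
  have hu0 : MemLp (u 0) 2 volume := hLH.memLp 0 ⟨le_rfl, hT.le⟩
  have hdis := (IsLerayHopfOn.lintegral_frobeniusNormSq_fderiv_of_classical hcl hLH hT).1
  have hpress := SereginSverak2002.lintegral_slab_gauged_pressure_lt_top hν hT hcl hLH
  refine ⟨G,
    { isConnected := ?_
      energyClass := ?_
      weakGradient := hG.mono hΩle
      gradient_lt_top := ?_
      pressure_lt_top := (lintegral_mono_set hΩsub).trans_lt hpress
      force_memLp := ?_
      distributional := (hsw.of_le hΩle).distributional
      localEnergy := fun φ hφ hφ0 => hloc φ (hφ.mono hΩle) hφ0 }⟩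
  · -- a cylinder is connected
    rw [hΩ, parabolicCylinder]
    refine ⟨⟨(T - r ^ 2 / 2, x₀), ?_⟩, ((convex_Ioo _ _).prod (convex_ball _ _)).isPreconnected⟩
    exact ⟨⟨by nlinarith, by nlinarith⟩, mem_ball_self hr⟩
  · -- `u ∈ L^∞_t L²_x(Ω)`: one bound from Leray's energy inequality
    refine ⟨((eLpNorm (u 0) 2 volume) ^ 2).toNNReal, ae_of_all _ fun t => ?_⟩
    rw [ENNReal.coe_toNNReal (ENNReal.pow_ne_top hu0.eLpNorm_ne_top)]
    by_cases ht : t ∈ Icc 0 T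
    · have h2 := eLpNorm_natCast_pow_eq_lintegral volume (u t) (n := 2) (by norm_num)
      simp only [Nat.cast_ofNat] at h2
      calc ∫⁻ x, (Ω : Set (ℝ × EuclideanSpace ℝ (Fin 3))).indicator
            (fun z : ℝ × EuclideanSpace ℝ (Fin 3) => ‖u z.1 z.2‖ₑ ^ 2) (t, x)
          ≤ ∫⁻ x, ‖u t x‖ₑ ^ 2 := lintegral_mono fun x => indicator_le_self _ _ _
        _ = eLpNorm (u t) 2 volume ^ 2 := h2.symm
        _ ≤ eLpNorm (u 0) 2 volume ^ 2 :=
          pow_le_pow_left' (hLH.eLpNorm_le_eLpNorm_datum hν.le hu0 ht) 2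
    · have h0 : ∀ x, (Ω : Set (ℝ × EuclideanSpace ℝ (Fin 3))).indicator
          (fun z : ℝ × EuclideanSpace ℝ (Fin 3) => ‖u z.1 z.2‖ₑ ^ 2) (t, x) = 0 := by
        intro x
        rw [indicator_of_notMem]
        intro hz
        exact ht ⟨(hΩsub hz).1.1.le, (hΩsub hz).1.2.le⟩
      simp only [h0, lintegral_zero, zero_le]
  · -- `∇u ∈ L²(Ω)` through `T`
    have e : ∫⁻ w in (Ω : Set (ℝ × EuclideanSpace ℝ (Fin 3))),
        ENNReal.ofReal (frobeniusNormSq (G w.1 w.2)) =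
          ∫⁻ w in (Ω : Set (ℝ × EuclideanSpace ℝ (Fin 3))),
            ENNReal.ofReal (frobeniusNormSq (fderiv ℝ (u w.1) w.2)) := by
      refine lintegral_congr_ae ?_
      have hae' := ae_restrict_of_ae_restrict_of_subset (μ := volume) hΩle hae
      filter_upwards [hae'] with w hw
      change ENNReal.ofReal (frobeniusNormSq (uncurry G w)) =
        ENNReal.ofReal (frobeniusNormSq (uncurry (fun t x => fderiv ℝ (u t) x) w))
      rw [hw]
    rw [e]
    exact ((lintegral_mono_set hΩsub).trans
      (SereginSverak2002.lintegral_slab_le_lintegral_lintegral _ _)).trans_lt hdis.lt_top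
  · -- the zero force
    have h0 : uncurry (0 : ℝ → EuclideanSpace ℝ (Fin 3) → EuclideanSpace ℝ (Fin 3)) = 0 := rfl
    rw [h0]
    exact MemLp.zero

/-- **STUB 4 of LINE 9 «trace_transfer», registered signature with `LocalSliceL3Bound` unfolded verbatim**
(Escauriaza–Seregin–Šverák 2003, Thm. 1.4, local, at the vertex `(T, x₀)`): for `ν > 0`, `T > 0`, `(u, p)`
classical on `[0, T) × ℝ³` and Leray–Hopf on `[0, T]` from the (rapidly decaying) datum `u 0`, if for some
`C`, `t₀ < T` the slices obey `∫_{B(x₀, ρ)} |u(s)|³ ≤ C` for all `s ∈ (t₀, T)` (`ρ > 0`), then `u` is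
essentially bounded on some backward parabolic cylinder `Q_r(T, x₀)`, `r > 0`. Proof: the §14.3 class on a top
cylinder of radius `min(ρ, √T, √(T − t₀))` (`exists_isLRSuitableWeakSolutionOn_cylinder_top_of_classical`) and
`ess_bounded_near_top_of_L3` at `z = (T, x₀)`. [cite: EscauriazaSereginSverak2003, Thm. 1.4 and §3] -/
theorem stub_regular_of_localSliceL3 :
    ∀ (ν T : ℝ), 0 < ν → 0 < T →
      ∀ (u : ℝ → EuclideanSpace ℝ (Fin 3) → EuclideanSpace ℝ (Fin 3)) (p : ℝ → EuclideanSpace ℝ (Fin 3) → ℝ),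
        IsClassicalNSSolutionOn (Set.Ico 0 T) ν 0 u p → IsLerayHopfOn T ν 0 (u 0) u →
        HasRapidSpatialDecay (u 0) → ∀ (x₀ : EuclideanSpace ℝ (Fin 3)) (ρ : ℝ), 0 < ρ →
        (∃ C t₀ : ℝ, t₀ < T ∧ ∀ s ∈ Set.Ioo t₀ T, ∫⁻ x in ball x₀ ρ, ‖u s x‖ₑ ^ 3 ≤ ENNReal.ofReal C) →
        ∃ r : ℝ, 0 < r ∧
          eLpNorm (uncurry u) ⊤ (volume.restrict (parabolicCylinder r (T, x₀))) < ⊤ := by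
  intro ν T hν hT u p hcl hLH _hdec x₀ ρ hρ hloc
  obtain ⟨C, t₀, ht₀T, hC⟩ := hloc
  -- a radius `r ≤ ρ` with `r² ≤ T` and `r² ≤ T − t₀`
  have hTt₀ : 0 < T - t₀ := sub_pos.2 ht₀T
  set r : ℝ := min ρ (min (Real.sqrt T) (Real.sqrt (T - t₀))) with hr_def
  have hr : 0 < r := lt_min hρ (lt_min (Real.sqrt_pos.2 hT) (Real.sqrt_pos.2 hTt₀))
  have hrρ : r ≤ ρ := min_le_left _ _
  have hrT : r ^ 2 ≤ T := by
    have h1 : r ≤ Real.sqrt T := (min_le_right _ _).trans (min_le_left _ _)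
    calc r ^ 2 ≤ Real.sqrt T ^ 2 := pow_le_pow_left₀ hr.le h1 2
      _ = T := Real.sq_sqrt hT.le
  have hrt₀ : r ^ 2 ≤ T - t₀ := by
    have h1 : r ≤ Real.sqrt (T - t₀) := (min_le_right _ _).trans (min_le_right _ _)
    calc r ^ 2 ≤ Real.sqrt (T - t₀) ^ 2 := pow_le_pow_left₀ hr.le h1 2
      _ = T - t₀ := Real.sq_sqrt hTt₀.le
  -- the §14.3 class on `Q_r(T, x₀)` and the transported `L³` bound
  obtain ⟨G, hLR⟩ := exists_isLRSuitableWeakSolutionOn_cylinder_top_of_classical hν hT hcl hLH x₀ hr hrT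
  have hL3 : ∃ C' : ℝ≥0, ∀ᵐ t ∂(volume.restrict (Ioo (T - r ^ 2) T)),
      ∫⁻ x in ball x₀ r, ‖u t x‖ₑ ^ 3 ≤ C' := by
    refine ⟨C.toNNReal, (ae_restrict_mem measurableSet_Ioo).mono fun t ht => ?_⟩
    have ht' : t ∈ Ioo t₀ T := ⟨by linarith [ht.1], ht.2⟩
    calc ∫⁻ x in ball x₀ r, ‖u t x‖ₑ ^ 3 ≤ ∫⁻ x in ball x₀ ρ, ‖u t x‖ₑ ^ 3 :=
          lintegral_mono_set (ball_subset_ball hrρ)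
      _ ≤ ENNReal.ofReal C := hC t ht'
      _ = (C.toNNReal : ℝ≥0∞) := rfl
  -- ESS Thm. 1.4 at the top point `(T, x₀)`
  obtain ⟨r₁, hr₁, hbd⟩ := ess_bounded_near_top_of_L3 hν hLR hL3 ((T : ℝ), x₀)
    ⟨by simp only; nlinarith, le_rfl⟩ (mem_ball_self hr)
  exact ⟨r₁, hr₁, hbd⟩

end Summit.NavierStokesRegularity.NavierStokesRegularity.Theorems.EnstrophyQuarterLaw.TraceTransfer

end
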